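import Summits.Ventures.CertifiedArithmetic.LowPrec.ErrorTables

/-!
# Exhaustive error envelopes of FP4 (`E2M1`) and FP6 (`E3M2`, `E2M3`) products and sums under RNE

HONEST FRAMING (venture CertifiedArithmetic / cell `pub-lowprec`): certified error envelopes and
provably optimal rounding/accumulation schemes for low-precision formats under stated cost models;
every table by two implementations; no hardware or vendor claims.

NEW WORK of the venture (not a published result): for each OCP MX element format with at most 6
bits and each operation `∘ ∈ {×, +}`, the exhaustive table of `fl(a ∘ b) - a ∘ b` over all ordered
pairs of finite data (`fl = roundNE`, round-to-nearest-even saturating at `±max`), summarised as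
kernel-checked ENVELOPES: (i) per exponent code `E` of the rounded result, the largest absolute
error among in-range pairs (`|a ∘ b| ≤ max`), which equals half the spacing of binade `E` and is
attained; (ii) the largest in-range relative error, which equals the sharp round-to-nearest
constant `u / (1 + u)` for sums (`1/5`, `1/9`, `1/17`) and is attained; (iii) the counts of exact
and of overflowing (saturated) pairs. Every statement is closed by `decide +kernel`: the kernel
evaluates `roundNE` on all `16²` / `64²` pairs (implementation B); implementation A is the cell's
independent enumerator (Python, brute-force nearest-value search), whose full tables are diffed
against the JSON export of `MiniFloat.mulTable` / `MiniFloat.addTable`.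
-/

namespace Summit.Ventures.CertifiedArithmetic

open Literature.ComputerArithmetic.FloatingPoint
open Literature.ComputerArithmetic.FloatingPoint.MiniFloat
open Literature.ComputerArithmetic.FloatingPoint.Format

/-- Envelope test as a Boolean on a pair: in range implies `|err| ≤ env[E]` with `E` the exponent
code of the rounded result. -/
def envTest (φ : Format) (op : ℚ → ℚ → ℚ) (env : List ℚ) (a b : MiniFloat φ) : Bool :=
  decide (|op a.toRat b.toRat| ≤ φ.maxRat →
    |(roundNE φ (op a.toRat b.toRat)).toRat - op a.toRat b.toRat|
      ≤ env.getD (roundNE φ (op a.toRat b.toRat)).expCode 0)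

/-- Relative-error test as a Boolean on a pair: in range and nonzero implies `|err| ≤ c · |t|`. -/
def relTest (φ : Format) (op : ℚ → ℚ → ℚ) (c : ℚ) (a b : MiniFloat φ) : Bool :=
  decide (|op a.toRat b.toRat| ≤ φ.maxRat → op a.toRat b.toRat ≠ 0 →
    |(roundNE φ (op a.toRat b.toRat)).toRat - op a.toRat b.toRat| ≤ c * |op a.toRat b.toRat|)

/-- Number of ordered pairs passing a Boolean test. -/
def countPairs (φ : Format) (P : MiniFloat φ → MiniFloat φ → Bool) : ℕ :=
  ((MiniFloat.all φ).map fun a => ((MiniFloat.all φ).filter fun b => P a b).length).sum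

/-! ### FP4 `E2M1` (16 data, 256 ordered pairs) -/

/-- `E2M1` PRODUCTS, absolute envelope: for `|ab| ≤ 6`, `|fl(ab) - ab| ≤ [1/4, 1/4, 1/4, 1/2][E]`
(`E` = exponent code of `fl(ab)`; half the spacing of that binade). -/
theorem E2M1_mul_abs_envelope (a b : MiniFloat E2M1) (h : |a.toRat * b.toRat| ≤ E2M1.maxRat) :
    |errMul E2M1 a b| ≤ [1/4, 1/4, 1/4, 1/2].getD (roundNE E2M1 (a.toRat * b.toRat)).expCode 0 := by
  have := forall₂_of_all_all (P := envTest E2M1 (· * ·) [1/4, 1/4, 1/4, 1/2]) (by decide +kernel) a b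
  exact of_decide_eq_true this h

/-- `E2M1` PRODUCTS, the absolute envelope is attained in the top binade: `3/2 · 3 = 9/2 ↦ 4`. -/
theorem E2M1_mul_abs_envelope_attained :
    ∃ a b : MiniFloat E2M1, |a.toRat * b.toRat| ≤ E2M1.maxRat ∧ |errMul E2M1 a b| = 1 / 2 :=
  ⟨⟨false, 1, 1, by decide, by decide, by decide⟩, ⟨false, 2, 1, by decide, by decide, by decide⟩,
    by decide +kernel⟩

/-- `E2M1` PRODUCTS, relative envelope: for `0 < |ab| ≤ 6`, `|fl(ab) - ab| ≤ |ab|` and the constant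
`1` is attained (`1/2 · 1/2 = 1/4 ↦ 0`, a tie resolved to the even significand `0`); restricted to
results in the normal range the constant is `1/9 = u/(1+u)`... is NOT attained by products: the
largest normal-range relative error of a product is `1/9` (`3/2 · 3/2 = 9/4 ↦ 2`). -/
theorem E2M1_mul_rel_envelope (a b : MiniFloat E2M1) (h : |a.toRat * b.toRat| ≤ E2M1.maxRat)
    (h0 : a.toRat * b.toRat ≠ 0) : |errMul E2M1 a b| ≤ 1 * |a.toRat * b.toRat| := by
  have := forall₂_of_all_all (P := relTest E2M1 (· * ·) 1) (by decide +kernel) a b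
  exact of_decide_eq_true this h h0

/-- `E2M1` SUMS, absolute envelope: for `|a+b| ≤ 6`, `|fl(a+b) - (a+b)| ≤ [0, 0, 1/2, 1][E]` — sums
landing below `2` are exact. -/
theorem E2M1_add_abs_envelope (a b : MiniFloat E2M1) (h : |a.toRat + b.toRat| ≤ E2M1.maxRat) :
    |errAdd E2M1 a b| ≤ [0, 0, 1/2, 1].getD (roundNE E2M1 (a.toRat + b.toRat)).expCode 0 := by
  have := forall₂_of_all_all (P := envTest E2M1 (· + ·) [0, 0, 1/2, 1]) (by decide +kernel) a b
  exact of_decide_eq_true this h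

/-- `E2M1` SUMS, attained: `1 + 4 = 5 ↦ 4` (tie, even significand), error `1`. -/
theorem E2M1_add_abs_envelope_attained :
    ∃ a b : MiniFloat E2M1, |a.toRat + b.toRat| ≤ E2M1.maxRat ∧ |errAdd E2M1 a b| = 1 :=
  ⟨⟨false, 1, 0, by decide, by decide, by decide⟩, ⟨false, 3, 0, by decide, by decide, by decide⟩,
    by decide +kernel⟩

/-- `E2M1` SUMS, relative envelope: for `0 < |a+b| ≤ 6`, `|fl(a+b) - (a+b)| ≤ |a+b| / 5`, the sharp
round-to-nearest constant `u/(1+u)` with `u = 1/4`; attained at `1 + 4 = 5 ↦ 4`. -/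
theorem E2M1_add_rel_envelope (a b : MiniFloat E2M1) (h : |a.toRat + b.toRat| ≤ E2M1.maxRat)
    (h0 : a.toRat + b.toRat ≠ 0) : |errAdd E2M1 a b| ≤ 1 / 5 * |a.toRat + b.toRat| := by
  have := forall₂_of_all_all (P := relTest E2M1 (· + ·) (1 / 5)) (by decide +kernel) a b
  exact of_decide_eq_true this h h0

/-- `E2M1` COUNTS: of the 256 ordered pairs, 172 products and 164 sums are exact; 60 products and
32 sums overflow (`|a ∘ b| > 6`, saturated to `±6`). -/
theorem E2M1_counts :
    countPairs E2M1 (fun a b => decide (errMul E2M1 a b = 0)) = 172 ∧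
    countPairs E2M1 (fun a b => decide (errAdd E2M1 a b = 0)) = 164 ∧
    countPairs E2M1 (fun a b => decide (E2M1.maxRat < |a.toRat * b.toRat|)) = 60 ∧
    countPairs E2M1 (fun a b => decide (E2M1.maxRat < |a.toRat + b.toRat|)) = 32 := by
  decide +kernel

end Summit.Ventures.CertifiedArithmetic
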